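import Mathlib
import Literature.NumberTheory.LFunctions.Zhang2022.Section15GammaFactorSteps
import Literature.NumberTheory.LFunctions.Zhang2022.Section8Step8u016
import HarnessLib

/-!
# Zhang (2022), §15 p. 80: the EXACT `ψ`-independent gamma weight of the reflected integrand `𝔨₁(s,ψ)`
# ("by (2.2), (2.4), (2.5), Lemma 5.1 and `τ(χψ) = τ(χ)τ(ψ)ψ(D)χ(p)`" made exact), kernel-checked

Topic `Literature/NumberTheory/LFunctions/Zhang2022` (Landau–Siegel audit tree; verdict-neutral).
Y. Zhang, *Discrete mean estimates and the Landau–Siegel zero*, arXiv:2211.02515v1 (2022)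
[Zhang2022LandauSiegel] — **an unrefereed manuscript under adjudication; nothing here asserts or denies
its Theorems 1–2.** Lane ZHANG-L, the (15.4) chain `§15.u004–u012` under the leaf `Typed.Section15A.Eq15_6`.

§15 p. 80 (tex L4017–L4035) rewrites, for `ψ ∈ Ψ₁` and `s` on `𝔍(−α)` resp. `𝔍(−1)`, the integrand
`𝔨₁(s,ψ) = Z(s,χψ)⁻¹·(L(s+β₁,ψ)L(s+β₂,ψ)/L(s,ψ))·B(s,ψ)K(1−s−β₃,ψ̄)` of `I₂⁻(ψ)` as
`τ(χ)χ(p)(pt₀)^{−β₃}·(Σ_m k̃(m)ψ̄(Dm)(Dm)^{s−1})·B(s,ψ)·(1 + O(𝓛⁻¹²³))` (u004: (2.2) + Lemma 5.1; u006: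
(2.4)–(2.5); u007). The typed nodes `Step15_u004`/`Step15_u006` (the two `(1 + O(·))` factors) are tree
theorems (`Section15GammaFactorSteps`). This file records the same computation WITHOUT the `O`-terms:

* `GammaFactor.corrSign e s` — the (2.4)-correction of `GammaFactor.Zfac_eq` indexed by the SIGN
  `e = θ(−1)` instead of the character (`0` if `e = 1`, `i·cot(πs/2) − 1` otherwise);
  `GammaFactor.corr_eq_corrSign : corr θ s = corrSign (θ(−1)) s`;
* `gammaWeight c′ D p eχ eψ s` — **the exact gamma weight**
  `W = p^{−β₃}·ϑ(s+β₁)ϑ(s+β₂)ϑ(s)⁻²·(1+c_{eψ}(s+β₁))(1+c_{eψ}(s+β₂))/((1+c_{eψ}(s))(1+c_{eχeψ}(s)))`,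
  a function of `s` and of the DATA `(p, χ(−1), ψ(−1))` only — NOT of `ψ` itself;
* `Zfac_pair_div_eq_gammaWeight` — for `D ≥ 3`, `χ` real primitive, `ψ ∈ Ψ` and `Im s, Im(s+β₁),
  Im(s+β₂) > 0`: `Z(s+β₁,ψ)Z(s+β₂,ψ)/(Z(s,ψ)Z(s,χψ)) = τ(χ)χ(p)ψ̄(D)D^{s−1}·W` EXACTLY (the tree's
  exact (2.4) `GammaFactor.Zfac_eq` four times, `τ(χψ) = τ(χ)τ(ψ)ψ(D)χ(p)` = `step15_u005_holds`,
  `τ(χ)² = χ(−1)D`, `χ(p)² = 1`, `|ψ(D)| = 1`, `β₁ + β₂ = β₃`);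
* `frakk1_eq_gammaWeight_mul` — for every `c′`, for all large `D`, every `ψ ∈ Ψ` and every `s` with
  `Re s < 0`, `Im s ≥ 2`: **`𝔨₁(s,ψ) = τ(χ)·χ(p)·W_{p,χ(−1),ψ(−1)}(s)·(Σ_m k̃(m)ψ̄(Dm)(Dm)^{s−1})·B(s,ψ)`
  EXACTLY** (`Typed.Section15A.frakk1`, `ktildeSeries`, `Skeleton.Bpoly`), from the functional equation
  (2.2) (`GammaFactor.LFunction_eq_Zfac_mul`) at `s`, `s+β₁`, `s+β₂`, the previous display, and u007
  (`step15_u007_holds`).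

Why this matters (analysis note, not a claim): the manuscript's relative errors `(1 + O(𝓛⁻¹²³))`,
`(1 + O(e^{−πt}))` multiply an integrand whose absolute integral over `𝔍(−1)`, summed over `Ψ₁`, is NOT
`≪ 𝔓` (on `σ = −½`, `|B(s,ψ)| ≈ (PT⁻²)^{3/2}`); the `o(𝔓)` of (15.4) comes from cancellation
(orthogonality in `ψ` and the Gaussian `ω`), which survives only if the gamma factor is kept as an exact
weight depending on `ψ` through `(p, ψ(−1))` alone — this `W`. Bounds for `W` (`|W − (pt₀)^{−β₃}| ≪ 𝓛⁻¹²³`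
on the segments `𝔍(z)`, crude bounds on full lines) are left to a sibling file.

One new definition of an OBJECT (`gammaWeight`, plus the plumbing `corrSign`); no `Prop` is defined, no
named fact; axioms standard. Nothing about (15.4), Theorems 1–2 or Landau–Siegel zeros is asserted.

## References

* Y. Zhang, arXiv:2211.02515v1 (2022), §15 p. 80 (tex L4017–L4035); §2 (2.2)–(2.5) p. 4; §5 Lemma 5.1.
  [cite: Zhang2022LandauSiegel, §15 p. 80; §2 (2.2)–(2.5)]
* H. L. Montgomery, R. C. Vaughan, *Multiplicative Number Theory I* (CUP 2007), Thm 9.6–9.7, Cor 10.9.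
  [cite: MontgomeryVaughan2007, Thm 9.6–9.7, Cor 10.9]
-/

noncomputable section

open Complex Real ComplexConjugate

namespace Literature.NumberTheory.LFunctions.Zhang2022

namespace GammaFactor

/-- The (2.4)-correction indexed by the sign `e = θ(−1)`: `0` for `e = 1` (even), `i·cot(πs/2) − 1`
otherwise (odd) — so that `corr θ s = corrSign (θ(−1)) s`. [cite: Zhang2022LandauSiegel, §2 (2.4)] -/
def corrSign (e : ℂ) (s : ℂ) : ℂ :=
  if e = 1 then 0 else I * (Complex.cos (π * s / 2) / Complex.sin (π * s / 2)) - 1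

/-- `corr θ s = corrSign (θ(−1)) s` (`θ.Even ↔ θ(−1) = 1` by definition).
[cite: Zhang2022LandauSiegel, §2 (2.4)] -/
theorem corr_eq_corrSign {k : ℕ} (θ : DirichletCharacter ℂ k) (s : ℂ) :
    corr θ s = corrSign (θ (-1)) s := by
  unfold corr corrSign
  by_cases h : θ.Even
  · have h1 : θ (-1) = 1 := h
    rw [if_pos h, if_pos h1]
  · have h1 : θ (-1) ≠ 1 := h
    rw [if_neg h, if_neg h1]

/-- `1 + corrSign (θ(−1)) s ≠ 0` for `Im s > 0`. [cite: Zhang2022LandauSiegel, §2 (2.4)] -/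
theorem one_add_corrSign_ne_zero {k : ℕ} (θ : DirichletCharacter ℂ k) {s : ℂ} (hs : 0 < s.im) :
    1 + corrSign (θ (-1)) s ≠ 0 := by
  rw [← corr_eq_corrSign]; exact one_add_corr_ne_zero θ hs

end GammaFactor

namespace Typed.Section15A

open Literature.NumberTheory.LFunctions.Zhang2022.Skeleton
open Literature.NumberTheory.LFunctions.Zhang2022.GammaFactor

/-- **The exact gamma weight `W` of the reflected `𝔨₁`** (§15 p. 80, the product of the main terms and
`(1 + O(·))`-factors of u004 and u006 made exact):
`W = p^{−β₃}·ϑ(s+β₁)ϑ(s+β₂)/ϑ(s)² · (1+c_{eψ}(s+β₁))(1+c_{eψ}(s+β₂))/((1+c_{eψ}(s))(1+c_{eχeψ}(s)))`,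
`c_e = GammaFactor.corrSign e`, for the data `p` (modulus of `ψ`), `eχ = χ(−1)`, `eψ = ψ(−1)`. It
depends on `ψ` only through `p` and `ψ(−1)`; its main term on the window is `(pt₀)^{−β₃}`.
[cite: Zhang2022LandauSiegel, §15 p. 80] -/
def gammaWeight (c' : ℝ) (D p : ℕ) (eχ eψ : ℂ) (s : ℂ) : ℂ :=
  (p : ℂ) ^ (-beta3 c' D) *
    (vartheta (s + beta1 c' D) * vartheta (s + beta2 c' D) / vartheta s ^ 2) *
    ((1 + corrSign eψ (s + beta1 c' D)) * (1 + corrSign eψ (s + beta2 c' D)) /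
      ((1 + corrSign eψ s) * (1 + corrSign (eχ * eψ) s)))

section GammaPart

variable (c' : ℝ) {D : ℕ} [NeZero D] (χ : DirichletCharacter ℂ D) (x : Chr D)

/-- **`Z(s+β₁,ψ)Z(s+β₂,ψ)/(Z(s,ψ)Z(s,χψ)) = τ(χ)χ(p)ψ̄(D)D^{s−1}·W` EXACTLY** for `D ≥ 3`, `χ` real
primitive, `ψ ∈ Ψ`, and `Im s, Im(s+β₁), Im(s+β₂) > 0`: (2.4) exactly (`GammaFactor.Zfac_eq`) at
`θ = ψ` (points `s, s+β₁, s+β₂`) and `θ = χψ` (point `s`), `(χψ)(−1) = χ(−1)ψ(−1)`,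
`τ(χψ) = τ(χ)τ(ψ)ψ(D)χ(p)` (u005), `β₁ + β₂ = β₃`, `τ(χ)² = χ(−1)D`, `χ(p)² = 1`, `ψ(D)ψ̄(D) = 1`.
[cite: Zhang2022LandauSiegel, §15 p. 80; §2 (2.4)–(2.5)] -/
theorem Zfac_pair_div_eq_gammaWeight (hD : 3 ≤ D) (hq : χ.IsQuadratic) (hχ : χ.IsPrimitive) {s : ℂ}
    (hs : 0 < s.im) (hs1 : 0 < (s + beta1 c' D).im) (hs2 : 0 < (s + beta2 c' D).im) :
    Zfac x.ψ (s + beta1 c' D) * Zfac x.ψ (s + beta2 c' D) / (Zfac x.ψ s * Zpc χ x s) =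
      tau χ * χ (x.p : ZMod D) * conj (x.ψ (D : ZMod x.p)) * (D : ℂ) ^ (s - 1) *
        gammaWeight c' D x.p (χ (-1)) (x.ψ (-1)) s := by
  -- sizes and coprimality
  have hD0 : (D : ℂ) ≠ 0 := Nat.cast_ne_zero.mpr (by omega)
  have hp0 : (x.p : ℂ) ≠ 0 := Nat.cast_ne_zero.mpr x.prime.ne_zero
  have hDp : D < x.p := Typed.Sec14.lt_of_mem_primeWindow hD x.mem
  have hcopPD : Nat.Coprime x.p D :=
    (Nat.Prime.coprime_iff_not_dvd x.prime).mpr fun h => by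
      have := Nat.le_of_dvd (by omega) h; omega
  have hcop : Nat.Coprime D x.p := hcopPD.symm
  -- the four exact (2.4)'s
  have hZ0 := Zfac_eq x.ψ hs
  have hZ1 := Zfac_eq x.ψ hs1
  have hZ2 := Zfac_eq x.ψ hs2
  have hZθ : Zpc χ x s = (psiChi χ x) (-1) * tau (psiChi χ x) *
      ((D * x.p : ℕ) : ℂ) ^ (-s) * vartheta s * (1 + corr (psiChi χ x) s) := Zfac_eq (psiChi χ x) hs
  have hsign : (psiChi χ x) (-1) = χ (-1) * x.ψ (-1) := Section4.psiChi_neg_one χ x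
  have hτ : tau (psiChi χ x) = tau χ * tau x.ψ * x.ψ (D : ZMod x.p) * χ (x.p : ZMod D) :=
    step15_u005_holds D χ x hcop
  have hpow : ((D * x.p : ℕ) : ℂ) ^ (-s) = (D : ℂ) ^ (-s) * (x.p : ℂ) ^ (-s) := by
    have e1 : ((x.p : ℕ) : ℂ) = ((x.p : ℝ) : ℂ) := (Complex.ofReal_natCast x.p).symm
    have e0 : ((D : ℕ) : ℂ) = ((D : ℝ) : ℂ) := (Complex.ofReal_natCast D).symm
    have e2 : ((D * x.p : ℕ) : ℂ) = ((D : ℝ) : ℂ) * ((x.p : ℝ) : ℂ) := by push_cast; ring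
    rw [e2, e0, e1, Complex.mul_cpow_ofReal_nonneg (Nat.cast_nonneg D) (Nat.cast_nonneg x.p)]
  -- `p^{−(s+β₁)}p^{−(s+β₂)} = p^{−s}p^{−s}p^{−β₃}`
  have h12 : beta1 c' D + beta2 c' D = beta3 c' D := by
    simp only [beta1, beta2, beta3]; push_cast; ring
  have hpp : (x.p : ℂ) ^ (-(s + beta1 c' D)) * (x.p : ℂ) ^ (-(s + beta2 c' D)) =
      (x.p : ℂ) ^ (-s) * (x.p : ℂ) ^ (-s) * (x.p : ℂ) ^ (-beta3 c' D) := by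
    rw [← Complex.cpow_add _ _ hp0, ← Complex.cpow_add _ _ hp0, ← Complex.cpow_add _ _ hp0, ← h12]
    congr 1; ring
  -- corrections by sign
  have hc0 : corr x.ψ s = corrSign (x.ψ (-1)) s := corr_eq_corrSign x.ψ s
  have hc1 : corr x.ψ (s + beta1 c' D) = corrSign (x.ψ (-1)) (s + beta1 c' D) := corr_eq_corrSign x.ψ _
  have hc2 : corr x.ψ (s + beta2 c' D) = corrSign (x.ψ (-1)) (s + beta2 c' D) := corr_eq_corrSign x.ψ _
  have hcθ : corr (psiChi χ x) s = corrSign (χ (-1) * x.ψ (-1)) s := by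
    rw [corr_eq_corrSign, hsign]
  -- non-vanishing
  have hd0 : 1 + corrSign (x.ψ (-1)) s ≠ 0 := one_add_corrSign_ne_zero x.ψ hs
  have hdθ : 1 + corrSign (χ (-1) * x.ψ (-1)) s ≠ 0 := by
    rw [← hsign]; exact one_add_corrSign_ne_zero (psiChi χ x) hs
  have hϑ : vartheta s ≠ 0 := vartheta_ne_zero (ChiStirling.sin_pi_mul_ne_zero hs.ne')
  -- the algebraic identities
  have hττ : tau χ * tau χ = χ (-1) * D := by
    have h := Literature.NumberTheory.LFunctions.gaussSum_mul_gaussSum_inv χ hχ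
    rw [MulChar.IsQuadratic.inv hq] at h
    exact h
  have hχχ : χ (-1) * χ (-1) = 1 := by rw [← map_mul, neg_mul_neg, one_mul, map_one]
  have hee : x.ψ (-1) * x.ψ (-1) = 1 := by rw [← map_mul, neg_mul_neg, one_mul, map_one]
  have hχp : χ (x.p : ZMod D) * χ (x.p : ZMod D) = 1 := by
    have hu : IsUnit (x.p : ZMod D) := (ZMod.isUnit_iff_coprime x.p D).mpr hcopPD
    have hne : χ (x.p : ZMod D) ≠ 0 := (hu.map χ).ne_zero
    rcases hq (x.p : ZMod D) with h | h | h
    · exact absurd h hne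
    · rw [h, one_mul]
    · rw [h]; norm_num
  have hψD : conj (x.ψ (D : ZMod x.p)) * x.ψ (D : ZMod x.p) = 1 := by
    have hu : IsUnit (D : ZMod x.p) := (ZMod.isUnit_iff_coprime D x.p).mpr hcop
    have hn : ‖x.ψ (D : ZMod x.p)‖ = 1 := by
      have := DirichletCharacter.unit_norm_eq_one x.ψ hu.unit
      rwa [IsUnit.unit_spec] at this
    have hne : x.ψ (D : ZMod x.p) ≠ 0 := by
      intro h; rw [h, norm_zero] at hn; exact zero_ne_one hn
    rw [← Complex.inv_eq_conj hn, inv_mul_cancel₀ hne]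
  have hDpow : (D : ℂ) ^ (s - 1) * (D : ℂ) ^ (-s) = (D : ℂ)⁻¹ := by
    rw [← cpow_add _ _ hD0, show s - 1 + -s = (-1 : ℂ) by ring, cpow_neg_one]
  -- the denominator does not vanish
  have hDen : Zfac x.ψ s * Zpc χ x s ≠ 0 :=
    mul_ne_zero (Zfac_ne_zero x.prim hs)
      (Zfac_ne_zero (psiChiPrimitive_holds D χ x hD hχ) hs)
  rw [div_eq_iff hDen, hZ1, hZ2, hZ0, hZθ, hsign, hτ, hpow, hc0, hc1, hc2, hcθ, gammaWeight]
  -- abbreviations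
  set τχ : ℂ := tau χ
  set τψ : ℂ := tau x.ψ
  set e : ℂ := x.ψ (-1)
  set cχ : ℂ := χ (-1)
  set ψD : ℂ := x.ψ (D : ZMod x.p)
  set χp : ℂ := χ (x.p : ZMod D)
  set P0 : ℂ := (x.p : ℂ) ^ (-s)
  set Pβ : ℂ := (x.p : ℂ) ^ (-beta3 c' D)
  set Ds : ℂ := (D : ℂ) ^ (-s)
  set Ds1 : ℂ := (D : ℂ) ^ (s - 1)
  set ϑ₀ : ℂ := vartheta s
  set ϑ₁ : ℂ := vartheta (s + beta1 c' D)
  set ϑ₂ : ℂ := vartheta (s + beta2 c' D)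
  set d₀ : ℂ := 1 + corrSign e s
  set d₁ : ℂ := 1 + corrSign e (s + beta1 c' D)
  set d₂ : ℂ := 1 + corrSign e (s + beta2 c' D)
  set dθ : ℂ := 1 + corrSign (cχ * e) s
  -- the common factor
  set COM : ℂ := (τψ * τψ) * (P0 * P0 * Pβ) * ϑ₁ * ϑ₂ * d₁ * d₂ with hCOM
  have hL : e * τψ * (x.p : ℂ) ^ (-(s + beta1 c' D)) * ϑ₁ * d₁ *
      (e * τψ * (x.p : ℂ) ^ (-(s + beta2 c' D)) * ϑ₂ * d₂) = COM := by
    calc e * τψ * (x.p : ℂ) ^ (-(s + beta1 c' D)) * ϑ₁ * d₁ *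
          (e * τψ * (x.p : ℂ) ^ (-(s + beta2 c' D)) * ϑ₂ * d₂)
        = (e * e) * (τψ * τψ) *
            ((x.p : ℂ) ^ (-(s + beta1 c' D)) * (x.p : ℂ) ^ (-(s + beta2 c' D))) *
            ϑ₁ * ϑ₂ * d₁ * d₂ := by ring
      _ = COM := by rw [hee, hpp, hCOM]; ring
  have hR : τχ * χp * conj ψD * Ds1 *
      (Pβ * (ϑ₁ * ϑ₂ / ϑ₀ ^ 2) * (d₁ * d₂ / (d₀ * dθ))) *
      (e * τψ * P0 * ϑ₀ * d₀ * (cχ * e * (τχ * τψ * ψD * χp) * (Ds * P0) * ϑ₀ * dθ)) = COM := by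
    have hϑ2 : ϑ₀ ^ 2 / ϑ₀ ^ 2 = 1 := div_self (pow_ne_zero 2 hϑ)
    have hdd : d₀ * dθ / (d₀ * dθ) = 1 := div_self (mul_ne_zero hd0 hdθ)
    calc τχ * χp * conj ψD * Ds1 *
          (Pβ * (ϑ₁ * ϑ₂ / ϑ₀ ^ 2) * (d₁ * d₂ / (d₀ * dθ))) *
          (e * τψ * P0 * ϑ₀ * d₀ * (cχ * e * (τχ * τψ * ψD * χp) * (Ds * P0) * ϑ₀ * dθ))
        = (τχ * τχ) * (χp * χp) * (conj ψD * ψD) * cχ * (e * e) * (Ds1 * Ds) *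
            (ϑ₀ ^ 2 / ϑ₀ ^ 2) * (d₀ * dθ / (d₀ * dθ)) *
            ((τψ * τψ) * (P0 * P0 * Pβ) * ϑ₁ * ϑ₂ * d₁ * d₂) := by ring
      _ = (cχ * D) * 1 * 1 * cχ * 1 * (D : ℂ)⁻¹ * 1 * 1 * COM := by
          rw [hττ, hχp, hψD, hee, hDpow, hϑ2, hdd, hCOM]
      _ = (cχ * cχ) * ((D : ℂ) * (D : ℂ)⁻¹) * COM := by ring
      _ = COM := by rw [hχχ, mul_inv_cancel₀ hD0, one_mul, one_mul]
  rw [hL, hR]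

end GammaPart

section Frakk1

variable (c' : ℝ)

/-- `L₀ ≤ log D` once `D ≥ ⌈exp L₀⌉₊`. [folklore] -/
private theorem le_ell_of_ceil_exp_le_W {L₀ : ℝ} {D : ℕ} (hD : ⌈Real.exp L₀⌉₊ ≤ D) :
    L₀ ≤ ell D := by
  have h : Real.exp L₀ ≤ D := le_trans (Nat.le_ceil _) (by exact_mod_cast hD)
  exact (Real.le_log_iff_exp_le (lt_of_lt_of_le (Real.exp_pos _) h)).mpr h

/-- **The reflected integrand, EXACTLY**: for every `c′`, for all large `D` (real primitive `χ (mod D)`),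
every `ψ ∈ Ψ` and every `s` with `Re s < 0`, `Im s ≥ 2`:
`𝔨₁(s,ψ) = τ(χ)·χ(p)·W_{p,χ(−1),ψ(−1)}(s)·(Σ_m k̃(m)ψ̄(Dm)(Dm)^{s−1})·B(s,ψ)` — the functional
equation (2.2) at `s`, `s+β₁`, `s+β₂` (`GammaFactor.LFunction_eq_Zfac_mul`), the gamma identity
`Zfac_pair_div_eq_gammaWeight`, u007 (`step15_u007_holds`: `L(1−s−β₁,ψ̄)L(1−s−β₂,ψ̄)K(1−s−β₃,ψ̄)/
L(1−s,ψ̄) = Σ_m k̃(m)ψ̄(m)m^{s−1}`, `σ < 0`) and `ψ̄(D)D^{s−1}·ψ̄(m)m^{s−1} = ψ̄(Dm)(Dm)^{s−1}`. (For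
`D` large the shifts satisfy `|β_j| ≤ 1`, so `Im(s+β_j) > 0`.) [cite: Zhang2022LandauSiegel, §15 p. 80] -/
theorem frakk1_eq_gammaWeight_mul :
    ForAllLarge fun D _ χ => ∀ x : Chr D, ∀ s : ℂ, s.re < 0 → 2 ≤ s.im →
      frakk1 c' χ x s =
        tau χ * χ (x.p : ZMod D) * gammaWeight c' D x.p (χ (-1)) (x.ψ (-1)) s *
          ktildeSeries c' x s * Bpoly χ x s := by
  obtain ⟨C7, D₇, h7⟩ := step15_u007_holds c'
  refine ForAllLarge.of_le (max D₇ (max 3 ⌈Real.exp (π * |c'| + 3)⌉₊))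
    fun D _ χ hD hq hχ x s hre him => ?_
  have hD₇ : D₇ ≤ D := le_trans (le_max_left _ _) hD
  have hD3 : 3 ≤ D := le_trans (le_trans (le_max_left _ _) (le_max_right _ _)) hD
  have hℓc : π * |c'| + 3 ≤ ell D :=
    le_ell_of_ceil_exp_le_W (le_trans (le_trans (le_max_right _ _) (le_max_right _ _)) hD)
  have hℓ3 : 3 ≤ ell D := by nlinarith [Real.pi_pos, abs_nonneg c']
  have hℓ1 : 1 ≤ ell D := by linarith
  -- the shifts are at most `1` in size, so `Im(s+β_j) > 0`
  obtain ⟨hα0, hα6, -⟩ := Step8u016.alpha_small hℓ3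
  have hc8 : π * |c'| ≤ ell D ^ 8 := by
    have : ell D ≤ ell D ^ 8 := by
      calc ell D = ell D ^ 1 := (pow_one _).symm
        _ ≤ ell D ^ 8 := pow_le_pow_right₀ hℓ1 (by norm_num)
    linarith
  have hcα := Step8u016.abs_c_mul_alpha_ell_le_one (c' := c') hℓ3 hc8
  obtain ⟨hb1, hb2, -⟩ := Step8u016.abs_b_le_one c' hα0.le hα6 hcα
  obtain ⟨e1, e2, -⟩ := Section8aStatements.beta_eq_b_mul_I c' D
  have hs0 : 0 < s.im := by linarith
  have hs1 : 0 < (s + beta1 c' D).im := by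
    rw [e1]; simp; linarith [(abs_le.mp hb1).1]
  have hs2 : 0 < (s + beta2 c' D).im := by
    rw [e2]; simp; linarith [(abs_le.mp hb2).1]
  -- the functional equation at the three points
  have hFE0 : x.ψ.LFunction s = Zfac x.ψ s * x.ψ⁻¹.LFunction (1 - s) :=
    LFunction_eq_Zfac_mul x.prim x.p_ne_one hs0.ne'
  have hFE1 : x.ψ.LFunction (s + beta1 c' D) =
      Zfac x.ψ (s + beta1 c' D) * x.ψ⁻¹.LFunction (1 - s - beta1 c' D) := by
    rw [LFunction_eq_Zfac_mul x.prim x.p_ne_one hs1.ne',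
      show (1 : ℂ) - (s + beta1 c' D) = 1 - s - beta1 c' D by ring]
  have hFE2 : x.ψ.LFunction (s + beta2 c' D) =
      Zfac x.ψ (s + beta2 c' D) * x.ψ⁻¹.LFunction (1 - s - beta2 c' D) := by
    rw [LFunction_eq_Zfac_mul x.prim x.p_ne_one hs2.ne',
      show (1 : ℂ) - (s + beta2 c' D) = 1 - s - beta2 c' D by ring]
  -- u007 and the gamma identity
  have h7s := (h7 D χ hD₇ hq hχ).2 x s hre
  have hΓ := Zfac_pair_div_eq_gammaWeight c' χ x hD3 hq hχ hs0 hs1 hs2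
  -- `ψ̄(D)D^{s−1}·Σ_m k̃(m)ψ̄(m)/m^{1−s} = Σ_m k̃(m)ψ̄(Dm)/(Dm)^{1−s}`
  have hD0 : (D : ℂ) ≠ 0 := Nat.cast_ne_zero.mpr (by omega)
  have hser : conj (x.ψ (D : ZMod x.p)) * (D : ℂ) ^ (s - 1) *
      (∑' m : ℕ, ktilde c' D m * conj (x.ψ (m : ZMod x.p)) / (m : ℂ) ^ (1 - s)) =
        ktildeSeries c' x s := by
    rw [ktildeSeries, ← tsum_mul_left]
    refine tsum_congr fun m => ?_
    have hψm : conj (x.ψ (D : ZMod x.p)) * conj (x.ψ (m : ZMod x.p)) =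
        conj (x.ψ ((D * m : ℕ) : ZMod x.p)) := by
      rw [← map_mul, ← map_mul, Nat.cast_mul]
    have hDm : ((D * m : ℕ) : ℂ) ^ (1 - s) = (D : ℂ) ^ (1 - s) * (m : ℂ) ^ (1 - s) := by
      push_cast; exact Complex.natCast_mul_natCast_cpow D m (1 - s)
    have hDs : (D : ℂ) ^ (s - 1) = ((D : ℂ) ^ (1 - s))⁻¹ := by
      rw [show s - 1 = -(1 - s) by ring, Complex.cpow_neg]
    rw [hDm, hDs, ← hψm]
    have hD1 : (D : ℂ) ^ (1 - s) ≠ 0 := by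
      rw [Ne, Complex.cpow_eq_zero_iff, not_and_or]; exact Or.inl hD0
    field_simp
  -- assembly
  set Z0 := Zfac x.ψ s with hZ0
  set Z1 := Zfac x.ψ (s + beta1 c' D) with hZ1
  set Z2 := Zfac x.ψ (s + beta2 c' D) with hZ2
  set L0 := x.ψ⁻¹.LFunction (1 - s) with hL0
  set L1 := x.ψ⁻¹.LFunction (1 - s - beta1 c' D) with hL1
  set L2 := x.ψ⁻¹.LFunction (1 - s - beta2 c' D) with hL2
  set Kc := Kchar D (psiBarFn x) (1 - s - beta3 c' D) with hKc
  set S := ∑' m : ℕ, ktilde c' D m * conj (x.ψ (m : ZMod x.p)) / (m : ℂ) ^ (1 - s) with hS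
  have h7s' : L1 * L2 * Kc / L0 = S := h7s
  calc frakk1 c' χ x s
      = (Zpc χ x s)⁻¹ * (x.ψ.LFunction (s + beta1 c' D) * x.ψ.LFunction (s + beta2 c' D) /
          x.ψ.LFunction s) * Bpoly χ x s * Kc := rfl
    _ = (Zpc χ x s)⁻¹ * (Z1 * L1 * (Z2 * L2) / (Z0 * L0)) * Bpoly χ x s * Kc := by
        rw [hFE1, hFE2, hFE0]
    _ = (Zpc χ x s)⁻¹ * (Z1 * Z2 / Z0 * (L1 * L2 / L0)) * Bpoly χ x s * Kc := by
        rw [show Z1 * L1 * (Z2 * L2) = Z1 * Z2 * (L1 * L2) by ring, mul_div_mul_comm]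
    _ = Z1 * Z2 / (Z0 * Zpc χ x s) * (L1 * L2 * Kc / L0) * Bpoly χ x s := by ring
    _ = tau χ * χ (x.p : ZMod D) * conj (x.ψ (D : ZMod x.p)) * (D : ℂ) ^ (s - 1) *
          gammaWeight c' D x.p (χ (-1)) (x.ψ (-1)) s * S * Bpoly χ x s := by
        rw [hΓ, h7s']
    _ = tau χ * χ (x.p : ZMod D) * gammaWeight c' D x.p (χ (-1)) (x.ψ (-1)) s *
          (conj (x.ψ (D : ZMod x.p)) * (D : ℂ) ^ (s - 1) * S) * Bpoly χ x s := by ring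
    _ = tau χ * χ (x.p : ZMod D) * gammaWeight c' D x.p (χ (-1)) (x.ψ (-1)) s *
          ktildeSeries c' x s * Bpoly χ x s := by rw [hser]

end Frakk1

end Typed.Section15A

end Literature.NumberTheory.LFunctions.Zhang2022
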